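import Mathlib
import HarnessLib
import Literature.Analysis.FluidPDE.AxisymmetricEuler
import Literature.Analysis.FluidPDE.SwirlTransportProofs
import Literature.Analysis.FluidPDE.ClassicalSolution
import Summits.NavierStokesRegularity.NavierStokesRegularity.Theses.PoloidalWindowDoor
import Summits.NavierStokesRegularity.NavierStokesRegularity.Theorems.PoloidalWindowDoorPoloidalWindowRigiditySharper
import Summits.NavierStokesRegularity.NavierStokesRegularity.Theorems.PoloidalWindowDoorPoloidalWindowRigidityFlat
import Summits.NavierStokesRegularity.NavierStokesRegularity.Theorems.PoloidalWindowDoorPoloidalWindowRigidityScrewKinematics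
import Summits.NavierStokesRegularity.NavierStokesRegularity.Theorems.PoloidalWindowDoorPoloidalWindowRigidityWholeSpaceComparison
import Summits.NavierStokesRegularity.NavierStokesRegularity.Theorems.PoloidalWindowDoorPoloidalWindowRigidityScrewAssembly
import Summits.NavierStokesRegularity.NavierStokesRegularity.Theorems.PoloidalWindowDoorPoloidalWindowRigidityDecayingSlopeLiouville
import Summits.NavierStokesRegularity.NavierStokesRegularity.Theorems.PoloidalWindowDoorPoloidalWindowRigidityScrewPressure
import Summits.NavierStokesRegularity.NavierStokesRegularity.Theorems.PoloidalWindowDoorPoloidalWindowRigiditySourceGauge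
import Summits.NavierStokesRegularity.NavierStokesRegularity.Theorems.PoloidalWindowDoorPoloidalWindowRigidityStrainRate
import Summits.NavierStokesRegularity.NavierStokesRegularity.Theorems.PoloidalWindowDoorPoloidalWindowRigidityVerticalPeriod
import Summits.NavierStokesRegularity.NavierStokesRegularity.Theorems.PoloidalWindowDoorPoloidalWindowRigidityPeriodic
import Summits.NavierStokesRegularity.NavierStokesRegularity.Theorems.PoloidalWindowDoorPoloidalWindowRigidityRotatedLerayAllRates
import Summits.NavierStokesRegularity.NavierStokesRegularity.Theorems.PoloidalWindowDoorPoloidalWindowRigidityNearPeakCriticalProduction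
import Summits.NavierStokesRegularity.NavierStokesRegularity.Theorems.PoloidalWindowDoorPoloidalWindowRigidityEllipticSlopeUnconditional

/-!
# RESHAPED SKELETON `slicesharp-screw` REV 11 (K2 leads nsreg-p7 g3/g4 2026-08-26, ns-poloidal-K2-p1 g2 2026-08-27; rev 11 by the lead pro tem
# ns-poloidal-K2-p3 g2 2026-08-27T03:5xZ: the ELLIPTIC-SLOPE STRATUM folded — S2⁗ gains clause (viii) «no slice is elliptic-shear-pinched»,
# the rev-10 statement is now the theorem `residueSupercriticalNearPeak_rev10` via `…EllipticSlopeUnconditional` + `divFormLiouville_holds`;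
# (M) = HasTypeITimeDecay remains the only load-bearing hypothesis of S2⁗, refuter1 K-12/21/24/25) — crux `PoloidalWindowRigidity`
# (stmt-NavierStokesRegularity-19708): the slice-wise sharpened residue SPLIT along the screw-symmetric stratum

Composition: `PoloidalWindowRigidity` ⇐ (tree) `…Sharper.poloidalWindowRigidity_of_sliceSharpNonflatLiouville`
⇐ `sliceSharpNonflatLiouville_of_stubs` ⇐ `stub_screwStratum` ∧ `stub_sliceSharpNoScrewNonflatLiouville` (case split on
«invariant under some screw motion about a vertical axis»).  `stub_screwStratum` (CENSUS-K2G §12 Cor. B, cell-level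
proof) is in turn ASSEMBLED by the lead from the three registered support stubs `stub_screwKinematics` (L2),
`stub_screwPressure` (L3), `stub_decayingSlopeLiouville` (L4) and the tree files `…ClassRate` (L1, p450704) /
`…Screw` (p448482) / `…Degenerate.eq_zero_of_irrotational`; until that assembly lands it is itself a `sorry`, so the
three L-stubs are registered for the wave but do not yet enter the composition term.

Stubs: stub_screwKinematics (L2, tree) · stub_screwPressure (L3, tree) · stub_wholeSpaceComparison (L4a, tree) ·
stub_decayingSlopeLiouville (L4, tree) · stub_screwStratum (S1, assembled, tree) · stub_residueSupercriticalNearPeak (S2⁗ = THE OPEN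
RESIDUE, rev 10); S2‴ `stub_residueNoPeriodNoSpiral` (rev 9) is proved from S2⁗ + nsreg-p7 g5's near-peak critical-production theorem (tree
`…NearPeakCriticalProduction.critEnstrophy_le_of_critical_production_above`, p484908: production at most critical at every point of near-record scale-invariant
enstrophy forces the enstrophy record to be ≤ θ — so its negation is contradictory outright); S2″ `stub_residueAperiodicCriticalStrain` (rev 8) is proved from S2‴ + ns-poloidal-K2-p2's two M9 strata (tree
`…Periodic.nonflatLiouville_of_spatiallyPeriodic` — no spatial period in ANY direction, p466900 — and
`…RotatedLerayAllRates.eq_zero_of_spiralSelfSimilar_centre` — not rotating-self-similar about any vertical axis at ANY rate, p477648);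
S2′ `stub_residueNoScrewNoGauge` (rev 7) is proved from S2″ + the two M10 strata (tree
`…VerticalPeriod.nonflatLiouville_of_vertical_period`, `…StrainRate.nonflatLiouville_of_small_horizontal_strain`; CENSUS-K2G §16),
and the former S2 `stub_sliceSharpNoScrewNonflatLiouville` from S2′ + `…SourceGauge`.  Screw motion about the vertical axis through `c`
with pitch `κ`: `y ↦ c + rotZ (κ a) (y − c) + a • e₃` acting on fields by `rotZ (κ a)`; its Killing field is
`h(y) = e₃ + κ J (y − c)`, `J = rotGen`.

WHAT THIS IS NOT: not a proof of K2 — a registered decomposition; nothing about Clay (A).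
-/

-- the summit and its single sub-problem share the name (CONVENTIONS §1)
set_option linter.dupNamespace false

namespace Summit.NavierStokesRegularity.NavierStokesRegularity.Theses.PoloidalWindowDoor

open Set Function
open scoped RealInnerProductSpace InnerProductSpace Laplacian
open Literature.Analysis Literature.Analysis.FluidPDE
open Summit.NavierStokesRegularity.NavierStokesRegularity.Theorems.PoloidalWindowDoorPoloidalWindowRigiditySharper
open Summit.NavierStokesRegularity.NavierStokesRegularity.Theorems.PoloidalWindowDoorPoloidalWindowRigidityFlat

/-- **STUB L2 (screw kinematics).** A `C¹` field on `ℝ³` that is POLOIDAL along `e₃` (`(curl u)₂ ≡ 0`) and invariant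
under the screw motions of pitch `κ` about the vertical axis through `c` has screw component `θ = ⟪u, e₃ + κ J(· − c)⟫`
with horizontal gradient `(−ω₁, ω₀)` and `θ` constant along the axis; quantitatively: a vorticity bound `‖curl u‖ ≤ B`
(`B ≥ 0`) gives `|θ(y) − θ(c)| ≤ B ‖y − c‖` for all `y`. -/
theorem stub_screwKinematics :
    ∀ (u : EuclideanSpace ℝ (Fin 3) → EuclideanSpace ℝ (Fin 3)), ContDiff ℝ 1 u →
      (∀ y, Literature.Analysis.FluidPDE.curl u y 2 = 0) →
      ∀ (κ : ℝ) (c : EuclideanSpace ℝ (Fin 3)),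
      (∀ (a : ℝ) (y : EuclideanSpace ℝ (Fin 3)),
        u (c + Literature.Analysis.FluidPDE.rotZ (κ * a) (y - c) + a • EuclideanSpace.single 2 (1 : ℝ)) =
          Literature.Analysis.FluidPDE.rotZ (κ * a) (u y)) →
      ∀ (B : ℝ), 0 ≤ B → (∀ y, ‖Literature.Analysis.FluidPDE.curl u y‖ ≤ B) →
      ∀ y, |⟪u y, (EuclideanSpace.single 2 (1 : ℝ) : EuclideanSpace ℝ (Fin 3)) + κ • Literature.Analysis.FluidPDE.rotGen (y - c)⟫_ℝ
            - ⟪u c, (EuclideanSpace.single 2 (1 : ℝ) : EuclideanSpace ℝ (Fin 3))⟫_ℝ| ≤ B * ‖y - c‖ :=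
  Summit.NavierStokesRegularity.NavierStokesRegularity.Theorems.PoloidalWindowDoorPoloidalWindowRigidityScrewKinematics.stub_screwKinematics

/-- **STUB L3 (screw pressure).** Along a classical Navier–Stokes flow (viscosity `ν`, zero force) on an open time set
whose velocity slices are invariant under the screw motions of pitch `κ` about the vertical axis through `c`, the
screw component of the pressure gradient `⟪∇p, e₃ + κ J(· − c)⟫` is SPATIALLY CONSTANT on every slice
(`∇p = νΔu − ∂ₜu − (u·∇)u` is screw-equivariant, so `p ∘ S_a − p` is constant in space). -/
theorem stub_screwPressure :
    ∀ (S : Set ℝ), IsOpen S → ∀ (ν : ℝ)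
      (u : ℝ → EuclideanSpace ℝ (Fin 3) → EuclideanSpace ℝ (Fin 3)) (p : ℝ → EuclideanSpace ℝ (Fin 3) → ℝ),
      Literature.Analysis.FluidPDE.IsClassicalNSSolutionOn S ν 0 u p →
      ∀ (κ : ℝ) (c : EuclideanSpace ℝ (Fin 3)),
      (∀ t ∈ S, ∀ (a : ℝ) (y : EuclideanSpace ℝ (Fin 3)),
        u t (c + Literature.Analysis.FluidPDE.rotZ (κ * a) (y - c) + a • EuclideanSpace.single 2 (1 : ℝ)) =
          Literature.Analysis.FluidPDE.rotZ (κ * a) (u t y)) →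
      ∀ t ∈ S, ∀ x : EuclideanSpace ℝ (Fin 3),
        ⟪gradient (p t) x, (EuclideanSpace.single 2 (1 : ℝ) : EuclideanSpace ℝ (Fin 3)) + κ • Literature.Analysis.FluidPDE.rotGen (x - c)⟫_ℝ =
          ⟪gradient (p t) c, (EuclideanSpace.single 2 (1 : ℝ) : EuclideanSpace ℝ (Fin 3))⟫_ℝ :=
  Summit.NavierStokesRegularity.NavierStokesRegularity.Theorems.PoloidalWindowDoorPoloidalWindowRigidityScrewPressure.stub_screwPressure

/-- **STUB L4a (whole-space comparison, Tikhonov class; Lieberman 1996 Ch. II Cor. 2.5 + the classical exponential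
correction).**  On `ℝ³ × [t₀, t₁]`: a classical solution `w` of `∂ₜw + (b·∇)w − Δw = 0` (jointly continuous, `C²`
slices with `∇w`, `Δw` continuous in `t`, a classical time derivative `wt` continuous in `t` — NO joint `C²` asked, so
that `w = θ − ∫src` with a merely continuous source qualifies) with a continuous drift bounded by the CONSTANT `A` and
of LINEAR GROWTH `|w| ≤ M(1 + ‖x‖)`, and a classical nonnegative super-barrier `Ψ`
(`Ψₜ ≥ ΔΨ + A‖∇Ψ‖`, the regularity data of the tree's `paraboloid_comparison`) dominating `|w|` at `t₀`, satisfy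
`|w| ≤ Ψ` on the whole slab.  Route: tree `Literature…ParabolicComparison.paraboloid_comparison` on the balls
`‖x‖² ≤ R²` for `±w` against `Ψ + ζ_R`, `ζ_R = M(1+R) e^{λ(t−t₀)} e^{(‖x‖²+1)^{1/2} − (R²+1)^{1/2}}`, `λ = 4 + A`
(radial calculus `laplacian_comp_norm_sq`: `Δe^{(‖x‖²+1)^{1/2}} ≤ 4 e^{…}`, `‖∇e^{…}‖ ≤ e^{…}`), then `R → ∞`. -/
theorem stub_wholeSpaceComparison :
    ∀ (b : ℝ → EuclideanSpace ℝ (Fin 3) → EuclideanSpace ℝ (Fin 3)) (A M : ℝ)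
      (w Ψ Ψt : ℝ → EuclideanSpace ℝ (Fin 3) → ℝ) (t₀ t₁ : ℝ), t₀ < t₁ →
      ContinuousOn (Function.uncurry b) (Set.Icc t₀ t₁ ×ˢ Set.univ) →
      (∀ t ∈ Set.Icc t₀ t₁, ∀ x, ‖b t x‖ ≤ A) →
      ∀ (wt : ℝ → EuclideanSpace ℝ (Fin 3) → ℝ),
      ContinuousOn (Function.uncurry w) (Set.Icc t₀ t₁ ×ˢ Set.univ) →
      (∀ t ∈ Set.Icc t₀ t₁, ContDiff ℝ 2 (w t)) →
      (∀ x, ContinuousOn (fun τ => fderiv ℝ (w τ) x) (Set.Icc t₀ t₁)) →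
      (∀ x, ContinuousOn (fun τ => (Δ (w τ)) x) (Set.Icc t₀ t₁)) →
      (∀ x, ∀ t ∈ Set.Icc t₀ t₁, HasDerivAt (fun τ => w τ x) (wt t x) t) →
      (∀ x, ContinuousOn (fun τ => wt τ x) (Set.Icc t₀ t₁)) →
      (∀ t ∈ Set.Icc t₀ t₁, ∀ x, wt t x + fderiv ℝ (w t) x (b t x) - (Δ (w t)) x = 0) →
      (∀ t ∈ Set.Icc t₀ t₁, ∀ x, |w t x| ≤ M * (1 + ‖x‖)) →
      (∀ t, ContDiff ℝ 2 (Ψ t)) →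
      ContinuousOn (Function.uncurry Ψ) (Set.Icc t₀ t₁ ×ˢ Set.univ) →
      (∀ x, ∀ t ∈ Set.Icc t₀ t₁, HasDerivAt (fun τ => Ψ τ x) (Ψt t x) t) →
      (∀ x, ContinuousOn (fun τ => Ψt τ x) (Set.Icc t₀ t₁)) →
      (∀ x, ContinuousOn (fun τ => fderiv ℝ (Ψ τ) x) (Set.Icc t₀ t₁)) →
      (∀ x, ContinuousOn (fun τ => (Δ (Ψ τ)) x) (Set.Icc t₀ t₁)) →
      (∀ t ∈ Set.Icc t₀ t₁, ∀ x, (Δ (Ψ t)) x + A * ‖fderiv ℝ (Ψ t) x‖ ≤ Ψt t x) →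
      (∀ t ∈ Set.Icc t₀ t₁, ∀ x, 0 ≤ Ψ t x) →
      (∀ x, |w t₀ x| ≤ Ψ t₀ x) →
      ∀ t ∈ Set.Icc t₀ t₁, ∀ x, |w t x| ≤ Ψ t x :=
  Summit.NavierStokesRegularity.NavierStokesRegularity.Theorems.PoloidalWindowDoorPoloidalWindowRigidityWholeSpaceComparison.stub_wholeSpaceComparison

/-- **STUB L4 (ancient decaying-slope Liouville, CENSUS-K2G §12 Lemma 12.1).** Along a profile of the route's Type-I
class, a scalar `θ`, jointly `C²` on the open slab, solving `∂ₜθ + (v·∇)θ − Δθ = c(t)` pointwise with a source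
depending on time only, whose slope about a point decays (`|θ(t,x) − θ(t,x₀)| ≤ ε(t)‖x − x₀‖`, `ε` continuous on
`(−∞,0)`, `ε(t)√(−t) → 0` as `t → −∞`), is constant on every slice.  (Barrier `Ψ = ε(t₀)[(‖x−x₀‖² + 3|t₀|)^{1/2} + k(t)]`, `k′ = 2C/√(−t) + √(3/|t₀|)`; comparison = STUB L4a
(`stub_wholeSpaceComparison`) applied on the dyadic blocks `[s, s/4]` on which `‖v‖ ≤ C/√(−s/4) ≤ 2C/√(−t)`; then
`t₀ → −∞`.) -/
theorem stub_decayingSlopeLiouville :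
    ∀ (C : ℝ) (v : ℝ → EuclideanSpace ℝ (Fin 3) → EuclideanSpace ℝ (Fin 3)),
      Literature.Analysis.FluidPDE.HasTypeITimeDecay C v →
      ContinuousOn (Function.uncurry v) (Set.Iio (0 : ℝ) ×ˢ Set.univ) →
      (∀ s t : ℝ, s < t → t < 0 → ∀ x, v t x =
        Literature.Analysis.UnboundedOperators.heatExtension (v s) (t - s) x -
          Literature.Analysis.FluidPDE.oseenDuhamel 1 s v v t x) →
      (∀ t < 0, Literature.Analysis.FluidPDE.VectorCalculus.IsDivFree (v t)) →
      ∀ (θ : ℝ → EuclideanSpace ℝ (Fin 3) → ℝ) (src : ℝ → ℝ) (x₀ : EuclideanSpace ℝ (Fin 3)) (ε : ℝ → ℝ),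
      ContDiffOn ℝ 2 (Function.uncurry θ) (Set.Iio (0 : ℝ) ×ˢ Set.univ) →
      (∀ t < 0, ∀ x, deriv (fun τ => θ τ x) t + fderiv ℝ (θ t) x (v t x) - (Δ (θ t)) x = src t) →
      (∀ t < 0, ∀ x, |θ t x - θ t x₀| ≤ ε t * ‖x - x₀‖) →
      ContinuousOn ε (Set.Iio 0) →
      Filter.Tendsto (fun t => ε t * Real.sqrt (-t)) Filter.atBot (nhds 0) →
      ∀ t < 0, ∀ x, θ t x = θ t x₀ :=
  Summit.NavierStokesRegularity.NavierStokesRegularity.Theorems.PoloidalWindowDoorPoloidalWindowRigidityDecayingSlopeLiouville.stub_decayingSlopeLiouville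

/-- **STUB S1 (the screw-symmetric stratum is empty; CENSUS-K2G §12 Cor. B).** A profile of the route's Type-I class,
poloidal along `e₃`, that is invariant under the screw motions of some pitch `κ ≠ 0` about some vertical axis on every
slice vanishes identically.  ASSEMBLY (lead): `θ := v·h` has source `−h·∇p` (tree `…Screw.screwComponent_transport`,
poloidal), spatially constant (L3); slope `ε(t) = sup‖curl v(t)‖ ≤ C₂/(−t)` (tree `…ClassRate`, L2); L4 makes `θ`
constant on slices, L2's gradient identity gives `curl v ≡ 0`, and `…Degenerate.eq_zero_of_irrotational` ends. -/
theorem stub_screwStratum :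
    ∀ (C : ℝ) (v : ℝ → EuclideanSpace ℝ (Fin 3) → EuclideanSpace ℝ (Fin 3)),
      Literature.Analysis.FluidPDE.HasTypeITimeDecay C v →
      ContinuousOn (Function.uncurry v) (Set.Iio (0 : ℝ) ×ˢ Set.univ) →
      (∀ s t : ℝ, s < t → t < 0 → ∀ x, v t x =
        Literature.Analysis.UnboundedOperators.heatExtension (v s) (t - s) x -
          Literature.Analysis.FluidPDE.oseenDuhamel 1 s v v t x) →
      (∀ t < 0, Literature.Analysis.FluidPDE.VectorCalculus.IsDivFree (v t)) →
      (∀ s < 0, ∀ y, ⟪Literature.Analysis.FluidPDE.curl (v s) y, EuclideanSpace.single 2 1⟫_ℝ = 0) →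
      (∃ κ : ℝ, κ ≠ 0 ∧ ∃ c : EuclideanSpace ℝ (Fin 3), ∀ s < 0, ∀ (a : ℝ) (y : EuclideanSpace ℝ (Fin 3)),
        v s (c + Literature.Analysis.FluidPDE.rotZ (κ * a) (y - c) + a • EuclideanSpace.single 2 (1 : ℝ)) =
          Literature.Analysis.FluidPDE.rotZ (κ * a) (v s y)) →
      ∀ t < 0, ∀ x, v t x = 0 :=
  Summit.NavierStokesRegularity.NavierStokesRegularity.Theorems.PoloidalWindowDoorPoloidalWindowRigidityScrewAssembly.screwStratum_of_L2_L3_L4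
    stub_screwKinematics stub_screwPressure stub_decayingSlopeLiouville

/-- **STUB S2⁗ = THE OPEN RESIDUE** (reshaped by the lead ns-poloidal-K2-p1, gen 2, rev 10): S2‴ of rev 9 with ONE MORE excluded stratum, landed
by the third worker nsreg-p7 g5 (mechanism M10 AT the critical rate + the parabolic STRONG maximum principle p481746/p484155 + the enstrophy hot spot
p482100/p484395): (vii) SUPER-CRITICAL PRODUCTION AT NEAR-RECORD VORTICITY — for every level `θ ≥ 0` below some value of the scale-invariant enstrophy
`(−s)²|ω|²`, there is a point of enstrophy `> θ` where the production is STRICTLY super-critical, `|ω|² < (−s)⟪ω, Dv ω⟫` (tree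
`…NearPeakCriticalProduction.exists_supercritical_above`, p484908; its negation contradicts `critEnstrophy_le_of_critical_production_above` outright).
(vii) implies the plain form «∃ (s,y): |ω|² < (−s)⟪ω,Dvω⟫» (take θ = 0 at any point with ω ≠ 0, which (hrot) provides) and, for poloidal profiles, the
strain form «∃ (s,y,a ⊥ e₂): ‖a‖² < (−s)⟪Dv a, a⟫» (p473649 `production_le_of_horizontal_strain`), which sharpens (iv) from «every Λ < 1» to «Λ = 1
exceeded»; (iv) is kept byte-identical. -/
theorem stub_residueSupercriticalNearPeak :
    ∀ (C : ℝ) (v : ℝ → EuclideanSpace ℝ (Fin 3) → EuclideanSpace ℝ (Fin 3)),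
      Literature.Analysis.FluidPDE.HasTypeITimeDecay C v →
      ContinuousOn (Function.uncurry v) (Set.Iio (0 : ℝ) ×ˢ Set.univ) →
      (∀ s t : ℝ, s < t → t < 0 → ∀ x, v t x =
        Literature.Analysis.UnboundedOperators.heatExtension (v s) (t - s) x -
          Literature.Analysis.FluidPDE.oseenDuhamel 1 s v v t x) →
      (∀ t < 0, Literature.Analysis.FluidPDE.VectorCalculus.IsDivFree (v t)) →
      (∀ s < 0, ∀ y, ⟪Literature.Analysis.FluidPDE.curl (v s) y, EuclideanSpace.single 2 1⟫_ℝ = 0) →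
      (∀ s < 0, ∀ y, ⟪fderiv ℝ (v s) y (Literature.Analysis.FluidPDE.curl (v s) y), EuclideanSpace.single 2 1⟫_ℝ = 0) →
      (∀ s < 0, ∀ b : EuclideanSpace ℝ (Fin 3), b ≠ 0 → ∃ y,
        Literature.Analysis.FluidPDE.cross (Literature.Analysis.FluidPDE.curl (v s) y) b ≠ 0) →
      (∀ s < 0, ∃ y, fderiv ℝ (v s) y (EuclideanSpace.single 2 1) 0 ≠ 0 ∨
        fderiv ℝ (v s) y (EuclideanSpace.single 2 1) 1 ≠ 0) →
      (∀ s < 0, ∀ a : EuclideanSpace ℝ (Fin 3), a ≠ 0 → ⟪a, EuclideanSpace.single 2 1⟫_ℝ = 0 →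
        ∃ y, ⟪fderiv ℝ (v s) y a, EuclideanSpace.single 2 1⟫_ℝ ≠ 0) →
      (∀ s < 0, ∀ e : EuclideanSpace ℝ (Fin 3), e ≠ 0 → ∃ (y : EuclideanSpace ℝ (Fin 3)) (l : ℝ), v s (y + l • e) ≠ v s y) →
      (∀ s < 0, ∀ (L : EuclideanSpace ℝ (Fin 3) ≃ₗᵢ[ℝ] EuclideanSpace ℝ (Fin 3)) (c : EuclideanSpace ℝ (Fin 3)),
        ¬ Literature.Analysis.FluidPDE.IsAxisymmetric (fun y => L.symm (v s (L y + c)))) →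
      (∃ lam : ℝ, 0 < lam ∧ ∃ s < 0, ∃ y, lam • v (lam ^ 2 * s) (lam • y) ≠ v s y) →
      (∀ κ : ℝ, κ ≠ 0 → ∀ c : EuclideanSpace ℝ (Fin 3), ∃ s < 0, ∃ (a : ℝ) (y : EuclideanSpace ℝ (Fin 3)),
        v s (c + Literature.Analysis.FluidPDE.rotZ (κ * a) (y - c) + a • EuclideanSpace.single 2 (1 : ℝ)) ≠
          Literature.Analysis.FluidPDE.rotZ (κ * a) (v s y)) →
      (∀ (ψ : ℝ → EuclideanSpace ℝ (Fin 3) → ℝ) (src : ℝ → ℝ) (x₀ : EuclideanSpace ℝ (Fin 3)) (ε : ℝ → ℝ),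
        ContDiffOn ℝ 2 (Function.uncurry ψ) (Set.Iio (0 : ℝ) ×ˢ Set.univ) →
        (∀ t < 0, ∀ y, Literature.Analysis.FluidPDE.curl (v t) y 0 = fderiv ℝ (ψ t) y (EuclideanSpace.single 1 1) ∧
          Literature.Analysis.FluidPDE.curl (v t) y 1 = -fderiv ℝ (ψ t) y (EuclideanSpace.single 0 1)) →
        (∀ t < 0, ∀ x, |ψ t x - ψ t x₀| ≤ ε t * ‖x - x₀‖) →
        ContinuousOn ε (Set.Iio 0) →
        Filter.Tendsto (fun t => ε t * Real.sqrt (-t)) Filter.atBot (nhds 0) →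
        ∃ t < 0, ∃ x, deriv (fun τ => ψ τ x) t + fderiv ℝ (ψ t) x (v t x) - (Δ (ψ t)) x ≠ src t) →
      (∀ L : ℝ, 0 < L → ∃ s < 0, ∃ y, v s (y + L • EuclideanSpace.single 2 (1 : ℝ)) ≠ v s y) →
      (∀ Λ : ℝ, Λ < 1 → ∃ s < 0, ∃ (y a : EuclideanSpace ℝ (Fin 3)), ⟪a, EuclideanSpace.single 2 (1 : ℝ)⟫_ℝ = 0 ∧
        Λ * ‖a‖ ^ 2 < (-s) * ⟪fderiv ℝ (v s) y a, a⟫_ℝ) →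
      (∀ ℓ : EuclideanSpace ℝ (Fin 3), ℓ ≠ 0 → ∃ s < 0, ∃ y, v s (y + ℓ) ≠ v s y) →
      (∀ (c : EuclideanSpace ℝ (Fin 3)) (κ : ℝ), ∃ (r : ℝ), ∃ s < 0, ∃ y,
        Real.exp r • v (Real.exp r ^ 2 * s) (Real.exp r • Literature.Analysis.FluidPDE.rotZ (κ * r) y + c) ≠
          Literature.Analysis.FluidPDE.rotZ (κ * r) (v s (y + c))) →
      (∀ θ : ℝ, 0 ≤ θ → ∀ s₀ < 0, ∀ y₀ : EuclideanSpace ℝ (Fin 3),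
        θ < (-s₀) ^ 2 * ⟪Literature.Analysis.FluidPDE.curl (v s₀) y₀, Literature.Analysis.FluidPDE.curl (v s₀) y₀⟫_ℝ →
        ∃ s < 0, ∃ y, θ < (-s) ^ 2 * ⟪Literature.Analysis.FluidPDE.curl (v s) y, Literature.Analysis.FluidPDE.curl (v s) y⟫_ℝ ∧
          ⟪Literature.Analysis.FluidPDE.curl (v s) y, Literature.Analysis.FluidPDE.curl (v s) y⟫_ℝ <
            (-s) * ⟪Literature.Analysis.FluidPDE.curl (v s) y, fderiv ℝ (v s) y (Literature.Analysis.FluidPDE.curl (v s) y)⟫_ℝ) →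
      (∀ s < 0, ∀ μ₀ μ₁ : ℝ, 0 < μ₀ → ∃ y, ∀ m : ℝ, μ₀ ≤ m → m ≤ μ₁ →
        fderiv ℝ (v s) y (EuclideanSpace.single 2 1) 0 ≠ m * fderiv ℝ (v s) y (EuclideanSpace.single 0 1) 2 ∨
        fderiv ℝ (v s) y (EuclideanSpace.single 2 1) 1 ≠ m * fderiv ℝ (v s) y (EuclideanSpace.single 1 1) 2) →
      ¬ Literature.Analysis.FluidPDE.IsBackwardSingularPoint v 0 := by
  sorry

/-- **S2⁗ as stated in rev 10 (PROVED in rev 11 from the reshaped S2⁗ and the now-unconditional elliptic-slope stratum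
`…EllipticSlopeUnconditional.nonflatLiouville_of_ellipticShear'`, seat ns-poloidal-K2-p3 g2, H5 = De Giorgi–Nash–Moser Liouville
`Literature.Analysis.PDE.divFormLiouville_holds`)**: either some slice is elliptic-shear-pinched (`∂₂v_h = m∇_h v₂`, `m ∈ [μ₀,μ₁] ⊂ (0,∞)`
pointwise) — then `v ≡ 0` and the origin is regular — or every slice is off that stratum, which is clause (viii) of the reshaped stub. -/
theorem residueSupercriticalNearPeak_rev10 :
    ∀ (C : ℝ) (v : ℝ → EuclideanSpace ℝ (Fin 3) → EuclideanSpace ℝ (Fin 3)),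
      Literature.Analysis.FluidPDE.HasTypeITimeDecay C v →
      ContinuousOn (Function.uncurry v) (Set.Iio (0 : ℝ) ×ˢ Set.univ) →
      (∀ s t : ℝ, s < t → t < 0 → ∀ x, v t x =
        Literature.Analysis.UnboundedOperators.heatExtension (v s) (t - s) x -
          Literature.Analysis.FluidPDE.oseenDuhamel 1 s v v t x) →
      (∀ t < 0, Literature.Analysis.FluidPDE.VectorCalculus.IsDivFree (v t)) →
      (∀ s < 0, ∀ y, ⟪Literature.Analysis.FluidPDE.curl (v s) y, EuclideanSpace.single 2 1⟫_ℝ = 0) →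
      (∀ s < 0, ∀ y, ⟪fderiv ℝ (v s) y (Literature.Analysis.FluidPDE.curl (v s) y), EuclideanSpace.single 2 1⟫_ℝ = 0) →
      (∀ s < 0, ∀ b : EuclideanSpace ℝ (Fin 3), b ≠ 0 → ∃ y,
        Literature.Analysis.FluidPDE.cross (Literature.Analysis.FluidPDE.curl (v s) y) b ≠ 0) →
      (∀ s < 0, ∃ y, fderiv ℝ (v s) y (EuclideanSpace.single 2 1) 0 ≠ 0 ∨
        fderiv ℝ (v s) y (EuclideanSpace.single 2 1) 1 ≠ 0) →
      (∀ s < 0, ∀ a : EuclideanSpace ℝ (Fin 3), a ≠ 0 → ⟪a, EuclideanSpace.single 2 1⟫_ℝ = 0 →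
        ∃ y, ⟪fderiv ℝ (v s) y a, EuclideanSpace.single 2 1⟫_ℝ ≠ 0) →
      (∀ s < 0, ∀ e : EuclideanSpace ℝ (Fin 3), e ≠ 0 → ∃ (y : EuclideanSpace ℝ (Fin 3)) (l : ℝ), v s (y + l • e) ≠ v s y) →
      (∀ s < 0, ∀ (L : EuclideanSpace ℝ (Fin 3) ≃ₗᵢ[ℝ] EuclideanSpace ℝ (Fin 3)) (c : EuclideanSpace ℝ (Fin 3)),
        ¬ Literature.Analysis.FluidPDE.IsAxisymmetric (fun y => L.symm (v s (L y + c)))) →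
      (∃ lam : ℝ, 0 < lam ∧ ∃ s < 0, ∃ y, lam • v (lam ^ 2 * s) (lam • y) ≠ v s y) →
      (∀ κ : ℝ, κ ≠ 0 → ∀ c : EuclideanSpace ℝ (Fin 3), ∃ s < 0, ∃ (a : ℝ) (y : EuclideanSpace ℝ (Fin 3)),
        v s (c + Literature.Analysis.FluidPDE.rotZ (κ * a) (y - c) + a • EuclideanSpace.single 2 (1 : ℝ)) ≠
          Literature.Analysis.FluidPDE.rotZ (κ * a) (v s y)) →
      (∀ (ψ : ℝ → EuclideanSpace ℝ (Fin 3) → ℝ) (src : ℝ → ℝ) (x₀ : EuclideanSpace ℝ (Fin 3)) (ε : ℝ → ℝ),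
        ContDiffOn ℝ 2 (Function.uncurry ψ) (Set.Iio (0 : ℝ) ×ˢ Set.univ) →
        (∀ t < 0, ∀ y, Literature.Analysis.FluidPDE.curl (v t) y 0 = fderiv ℝ (ψ t) y (EuclideanSpace.single 1 1) ∧
          Literature.Analysis.FluidPDE.curl (v t) y 1 = -fderiv ℝ (ψ t) y (EuclideanSpace.single 0 1)) →
        (∀ t < 0, ∀ x, |ψ t x - ψ t x₀| ≤ ε t * ‖x - x₀‖) →
        ContinuousOn ε (Set.Iio 0) →
        Filter.Tendsto (fun t => ε t * Real.sqrt (-t)) Filter.atBot (nhds 0) →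
        ∃ t < 0, ∃ x, deriv (fun τ => ψ τ x) t + fderiv ℝ (ψ t) x (v t x) - (Δ (ψ t)) x ≠ src t) →
      (∀ L : ℝ, 0 < L → ∃ s < 0, ∃ y, v s (y + L • EuclideanSpace.single 2 (1 : ℝ)) ≠ v s y) →
      (∀ Λ : ℝ, Λ < 1 → ∃ s < 0, ∃ (y a : EuclideanSpace ℝ (Fin 3)), ⟪a, EuclideanSpace.single 2 (1 : ℝ)⟫_ℝ = 0 ∧
        Λ * ‖a‖ ^ 2 < (-s) * ⟪fderiv ℝ (v s) y a, a⟫_ℝ) →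
      (∀ ℓ : EuclideanSpace ℝ (Fin 3), ℓ ≠ 0 → ∃ s < 0, ∃ y, v s (y + ℓ) ≠ v s y) →
      (∀ (c : EuclideanSpace ℝ (Fin 3)) (κ : ℝ), ∃ (r : ℝ), ∃ s < 0, ∃ y,
        Real.exp r • v (Real.exp r ^ 2 * s) (Real.exp r • Literature.Analysis.FluidPDE.rotZ (κ * r) y + c) ≠
          Literature.Analysis.FluidPDE.rotZ (κ * r) (v s (y + c))) →
      (∀ θ : ℝ, 0 ≤ θ → ∀ s₀ < 0, ∀ y₀ : EuclideanSpace ℝ (Fin 3),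
        θ < (-s₀) ^ 2 * ⟪Literature.Analysis.FluidPDE.curl (v s₀) y₀, Literature.Analysis.FluidPDE.curl (v s₀) y₀⟫_ℝ →
        ∃ s < 0, ∃ y, θ < (-s) ^ 2 * ⟪Literature.Analysis.FluidPDE.curl (v s) y, Literature.Analysis.FluidPDE.curl (v s) y⟫_ℝ ∧
          ⟪Literature.Analysis.FluidPDE.curl (v s) y, Literature.Analysis.FluidPDE.curl (v s) y⟫_ℝ <
            (-s) * ⟪Literature.Analysis.FluidPDE.curl (v s) y, fderiv ℝ (v s) y (Literature.Analysis.FluidPDE.curl (v s) y)⟫_ℝ) →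
      ¬ Literature.Analysis.FluidPDE.IsBackwardSingularPoint v 0 := by
  intro C v hrate hcont hmild hdiv hpol hfro hrot hvr hflat htr hax hsc hns hng hvp hcs hper hrss hsup
  by_cases hell : ∃ s : ℝ, s < 0 ∧ ∃ μ₀ μ₁ : ℝ, 0 < μ₀ ∧ ∀ y, ∃ m : ℝ, μ₀ ≤ m ∧ m ≤ μ₁ ∧
      fderiv ℝ (v s) y (EuclideanSpace.single 2 1) 0 = m * fderiv ℝ (v s) y (EuclideanSpace.single 0 1) 2 ∧
      fderiv ℝ (v s) y (EuclideanSpace.single 2 1) 1 = m * fderiv ℝ (v s) y (EuclideanSpace.single 1 1) 2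
  · obtain ⟨s, hs, μ₀, μ₁, hμ₀, hshear⟩ := hell
    exact Summit.NavierStokesRegularity.NavierStokesRegularity.Theorems.PoloidalWindowDoorPoloidalWindowRigidityEllipticSlopeUnconditional.nonflatLiouville_of_ellipticShear'
      hrate hcont hmild hdiv hs (hpol s hs) hμ₀ hshear
  refine stub_residueSupercriticalNearPeak C v hrate hcont hmild hdiv hpol hfro hrot hvr hflat htr hax hsc hns hng hvp hcs hper hrss
    hsup ?_
  intro s hs μ₀ μ₁ hμ₀
  by_contra hno
  push Not at hno
  refine hell ⟨s, hs, μ₀, μ₁, hμ₀, fun y => ?_⟩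
  obtain ⟨m, hm0, hm1, h0, h1⟩ := hno y
  exact ⟨m, hm0, hm1, h0, h1⟩

/-- **S2‴ (rev 9; PROVED in rev 10 from S2⁗ and nsreg-p7 g5's `…NearPeakCriticalProduction`)**: S2″ of rev 8 with TWO MORE excluded
strata, both landed by the stub-worker ns-poloidal-K2-p2 (mechanism M9 = zoom-out symmetry gain / rotated-Leray Liouville):
(v) the profile has NO SPATIAL PERIOD IN ANY DIRECTION (tree `…Periodic.nonflatLiouville_of_spatiallyPeriodic`, p466900: a spatial
period `ℓ ≠ 0` on all slices forces `v ≡ 0` for the whole Type-I class — supersedes (iii) «no vertical period»), and (vi) it is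
NOT ROTATING-SELF-SIMILAR about any vertical axis at any rate (tree `…RotatedLerayAllRates.eq_zero_of_spiralSelfSimilar_centre`,
p477648: `e^r v(e^{2r}s, e^r R_{κr} y + c) = R_{κr} v(s, y + c)` for all `r` forces `v ≡ 0` on the poloidal class, every `κ`, every
centre `c`; `κ = 0` is backward self-similarity about `c`).  The hypotheses (iii) and «not scale-invariant about the origin» are now
redundant but kept byte-identical. -/
theorem stub_residueNoPeriodNoSpiral :
    ∀ (C : ℝ) (v : ℝ → EuclideanSpace ℝ (Fin 3) → EuclideanSpace ℝ (Fin 3)),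
      Literature.Analysis.FluidPDE.HasTypeITimeDecay C v →
      ContinuousOn (Function.uncurry v) (Set.Iio (0 : ℝ) ×ˢ Set.univ) →
      (∀ s t : ℝ, s < t → t < 0 → ∀ x, v t x =
        Literature.Analysis.UnboundedOperators.heatExtension (v s) (t - s) x -
          Literature.Analysis.FluidPDE.oseenDuhamel 1 s v v t x) →
      (∀ t < 0, Literature.Analysis.FluidPDE.VectorCalculus.IsDivFree (v t)) →
      (∀ s < 0, ∀ y, ⟪Literature.Analysis.FluidPDE.curl (v s) y, EuclideanSpace.single 2 1⟫_ℝ = 0) →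
      (∀ s < 0, ∀ y, ⟪fderiv ℝ (v s) y (Literature.Analysis.FluidPDE.curl (v s) y), EuclideanSpace.single 2 1⟫_ℝ = 0) →
      (∀ s < 0, ∀ b : EuclideanSpace ℝ (Fin 3), b ≠ 0 → ∃ y,
        Literature.Analysis.FluidPDE.cross (Literature.Analysis.FluidPDE.curl (v s) y) b ≠ 0) →
      (∀ s < 0, ∃ y, fderiv ℝ (v s) y (EuclideanSpace.single 2 1) 0 ≠ 0 ∨
        fderiv ℝ (v s) y (EuclideanSpace.single 2 1) 1 ≠ 0) →
      (∀ s < 0, ∀ a : EuclideanSpace ℝ (Fin 3), a ≠ 0 → ⟪a, EuclideanSpace.single 2 1⟫_ℝ = 0 →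
        ∃ y, ⟪fderiv ℝ (v s) y a, EuclideanSpace.single 2 1⟫_ℝ ≠ 0) →
      (∀ s < 0, ∀ e : EuclideanSpace ℝ (Fin 3), e ≠ 0 → ∃ (y : EuclideanSpace ℝ (Fin 3)) (l : ℝ), v s (y + l • e) ≠ v s y) →
      (∀ s < 0, ∀ (L : EuclideanSpace ℝ (Fin 3) ≃ₗᵢ[ℝ] EuclideanSpace ℝ (Fin 3)) (c : EuclideanSpace ℝ (Fin 3)),
        ¬ Literature.Analysis.FluidPDE.IsAxisymmetric (fun y => L.symm (v s (L y + c)))) →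
      (∃ lam : ℝ, 0 < lam ∧ ∃ s < 0, ∃ y, lam • v (lam ^ 2 * s) (lam • y) ≠ v s y) →
      (∀ κ : ℝ, κ ≠ 0 → ∀ c : EuclideanSpace ℝ (Fin 3), ∃ s < 0, ∃ (a : ℝ) (y : EuclideanSpace ℝ (Fin 3)),
        v s (c + Literature.Analysis.FluidPDE.rotZ (κ * a) (y - c) + a • EuclideanSpace.single 2 (1 : ℝ)) ≠
          Literature.Analysis.FluidPDE.rotZ (κ * a) (v s y)) →
      (∀ (ψ : ℝ → EuclideanSpace ℝ (Fin 3) → ℝ) (src : ℝ → ℝ) (x₀ : EuclideanSpace ℝ (Fin 3)) (ε : ℝ → ℝ),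
        ContDiffOn ℝ 2 (Function.uncurry ψ) (Set.Iio (0 : ℝ) ×ˢ Set.univ) →
        (∀ t < 0, ∀ y, Literature.Analysis.FluidPDE.curl (v t) y 0 = fderiv ℝ (ψ t) y (EuclideanSpace.single 1 1) ∧
          Literature.Analysis.FluidPDE.curl (v t) y 1 = -fderiv ℝ (ψ t) y (EuclideanSpace.single 0 1)) →
        (∀ t < 0, ∀ x, |ψ t x - ψ t x₀| ≤ ε t * ‖x - x₀‖) →
        ContinuousOn ε (Set.Iio 0) →
        Filter.Tendsto (fun t => ε t * Real.sqrt (-t)) Filter.atBot (nhds 0) →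
        ∃ t < 0, ∃ x, deriv (fun τ => ψ τ x) t + fderiv ℝ (ψ t) x (v t x) - (Δ (ψ t)) x ≠ src t) →
      (∀ L : ℝ, 0 < L → ∃ s < 0, ∃ y, v s (y + L • EuclideanSpace.single 2 (1 : ℝ)) ≠ v s y) →
      (∀ Λ : ℝ, Λ < 1 → ∃ s < 0, ∃ (y a : EuclideanSpace ℝ (Fin 3)), ⟪a, EuclideanSpace.single 2 (1 : ℝ)⟫_ℝ = 0 ∧
        Λ * ‖a‖ ^ 2 < (-s) * ⟪fderiv ℝ (v s) y a, a⟫_ℝ) →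
      (∀ ℓ : EuclideanSpace ℝ (Fin 3), ℓ ≠ 0 → ∃ s < 0, ∃ y, v s (y + ℓ) ≠ v s y) →
      (∀ (c : EuclideanSpace ℝ (Fin 3)) (κ : ℝ), ∃ (r : ℝ), ∃ s < 0, ∃ y,
        Real.exp r • v (Real.exp r ^ 2 * s) (Real.exp r • Literature.Analysis.FluidPDE.rotZ (κ * r) y + c) ≠
          Literature.Analysis.FluidPDE.rotZ (κ * r) (v s (y + c))) →
      ¬ Literature.Analysis.FluidPDE.IsBackwardSingularPoint v 0 := by
  intro C v hrate hcont hmild hdiv hpol hfro hrot hvr hflat htr hax hsc hns hng hvp hcs hper hrss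
  by_cases hcrit : ∃ θ : ℝ, 0 ≤ θ ∧ ∃ s₀ < 0, ∃ y₀ : EuclideanSpace ℝ (Fin 3),
      θ < (-s₀) ^ 2 * ⟪Literature.Analysis.FluidPDE.curl (v s₀) y₀, Literature.Analysis.FluidPDE.curl (v s₀) y₀⟫_ℝ ∧
      ∀ s < 0, ∀ y, θ < (-s) ^ 2 * ⟪Literature.Analysis.FluidPDE.curl (v s) y, Literature.Analysis.FluidPDE.curl (v s) y⟫_ℝ →
        (-s) * ⟪Literature.Analysis.FluidPDE.curl (v s) y, fderiv ℝ (v s) y (Literature.Analysis.FluidPDE.curl (v s) y)⟫_ℝ ≤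
          ⟪Literature.Analysis.FluidPDE.curl (v s) y, Literature.Analysis.FluidPDE.curl (v s) y⟫_ℝ
  · obtain ⟨θ, hθ, s₀, hs₀, y₀, habove, hle⟩ := hcrit
    exfalso
    have h := Summit.NavierStokesRegularity.NavierStokesRegularity.Theorems.PoloidalWindowDoorPoloidalWindowRigidityNearPeakCriticalProduction.critEnstrophy_le_of_critical_production_above
      hrate hcont hmild hdiv hθ hle s₀ hs₀ y₀
    exact absurd habove (not_lt.2 h)
  refine residueSupercriticalNearPeak_rev10 C v hrate hcont hmild hdiv hpol hfro hrot hvr hflat htr hax hsc hns hng hvp hcs hper hrss ?_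
  intro θ hθ s₀ hs₀ y₀ habove
  by_contra hno
  push Not at hno
  exact hcrit ⟨θ, hθ, s₀, hs₀, y₀, habove, fun s hs y hθ' => hno s hs y hθ'⟩

/-- **S2″ (rev 8; PROVED in rev 9 from S2‴ and ns-poloidal-K2-p2's strata `…Periodic`, `…RotatedLerayAllRates`)**: S2′ of rev 7 with TWO MORE excluded
strata (CENSUS-K2G §16, mechanism M9 = enstrophy Gronwall from `t = −∞`): (iii) the profile has NO vertical period
(tree `…VerticalPeriod.nonflatLiouville_of_vertical_period`: vertically periodic poloidal profiles are trivial — the mean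
horizontal flow is rigid, so vortex stretching is a pure fluctuation of integrable rate), and (iv) its HORIZONTAL STRAIN
REACHES EVERY SUB-CRITICAL RATE: for every `Λ < 1` some slice and some horizontal direction `a` have
`(−s)⟪Dv(s,y) a, a⟫ > Λ‖a‖²` (tree `…StrainRate.nonflatLiouville_of_small_horizontal_strain`: poloidal profiles whose
horizontal strain stays below the critical rate are trivial). -/
theorem stub_residueAperiodicCriticalStrain :
    ∀ (C : ℝ) (v : ℝ → EuclideanSpace ℝ (Fin 3) → EuclideanSpace ℝ (Fin 3)),
      Literature.Analysis.FluidPDE.HasTypeITimeDecay C v →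
      ContinuousOn (Function.uncurry v) (Set.Iio (0 : ℝ) ×ˢ Set.univ) →
      (∀ s t : ℝ, s < t → t < 0 → ∀ x, v t x =
        Literature.Analysis.UnboundedOperators.heatExtension (v s) (t - s) x -
          Literature.Analysis.FluidPDE.oseenDuhamel 1 s v v t x) →
      (∀ t < 0, Literature.Analysis.FluidPDE.VectorCalculus.IsDivFree (v t)) →
      (∀ s < 0, ∀ y, ⟪Literature.Analysis.FluidPDE.curl (v s) y, EuclideanSpace.single 2 1⟫_ℝ = 0) →
      (∀ s < 0, ∀ y, ⟪fderiv ℝ (v s) y (Literature.Analysis.FluidPDE.curl (v s) y), EuclideanSpace.single 2 1⟫_ℝ = 0) →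
      (∀ s < 0, ∀ b : EuclideanSpace ℝ (Fin 3), b ≠ 0 → ∃ y,
        Literature.Analysis.FluidPDE.cross (Literature.Analysis.FluidPDE.curl (v s) y) b ≠ 0) →
      (∀ s < 0, ∃ y, fderiv ℝ (v s) y (EuclideanSpace.single 2 1) 0 ≠ 0 ∨
        fderiv ℝ (v s) y (EuclideanSpace.single 2 1) 1 ≠ 0) →
      (∀ s < 0, ∀ a : EuclideanSpace ℝ (Fin 3), a ≠ 0 → ⟪a, EuclideanSpace.single 2 1⟫_ℝ = 0 →
        ∃ y, ⟪fderiv ℝ (v s) y a, EuclideanSpace.single 2 1⟫_ℝ ≠ 0) →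
      (∀ s < 0, ∀ e : EuclideanSpace ℝ (Fin 3), e ≠ 0 → ∃ (y : EuclideanSpace ℝ (Fin 3)) (l : ℝ), v s (y + l • e) ≠ v s y) →
      (∀ s < 0, ∀ (L : EuclideanSpace ℝ (Fin 3) ≃ₗᵢ[ℝ] EuclideanSpace ℝ (Fin 3)) (c : EuclideanSpace ℝ (Fin 3)),
        ¬ Literature.Analysis.FluidPDE.IsAxisymmetric (fun y => L.symm (v s (L y + c)))) →
      (∃ lam : ℝ, 0 < lam ∧ ∃ s < 0, ∃ y, lam • v (lam ^ 2 * s) (lam • y) ≠ v s y) →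
      (∀ κ : ℝ, κ ≠ 0 → ∀ c : EuclideanSpace ℝ (Fin 3), ∃ s < 0, ∃ (a : ℝ) (y : EuclideanSpace ℝ (Fin 3)),
        v s (c + Literature.Analysis.FluidPDE.rotZ (κ * a) (y - c) + a • EuclideanSpace.single 2 (1 : ℝ)) ≠
          Literature.Analysis.FluidPDE.rotZ (κ * a) (v s y)) →
      (∀ (ψ : ℝ → EuclideanSpace ℝ (Fin 3) → ℝ) (src : ℝ → ℝ) (x₀ : EuclideanSpace ℝ (Fin 3)) (ε : ℝ → ℝ),
        ContDiffOn ℝ 2 (Function.uncurry ψ) (Set.Iio (0 : ℝ) ×ˢ Set.univ) →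
        (∀ t < 0, ∀ y, Literature.Analysis.FluidPDE.curl (v t) y 0 = fderiv ℝ (ψ t) y (EuclideanSpace.single 1 1) ∧
          Literature.Analysis.FluidPDE.curl (v t) y 1 = -fderiv ℝ (ψ t) y (EuclideanSpace.single 0 1)) →
        (∀ t < 0, ∀ x, |ψ t x - ψ t x₀| ≤ ε t * ‖x - x₀‖) →
        ContinuousOn ε (Set.Iio 0) →
        Filter.Tendsto (fun t => ε t * Real.sqrt (-t)) Filter.atBot (nhds 0) →
        ∃ t < 0, ∃ x, deriv (fun τ => ψ τ x) t + fderiv ℝ (ψ t) x (v t x) - (Δ (ψ t)) x ≠ src t) →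
      (∀ L : ℝ, 0 < L → ∃ s < 0, ∃ y, v s (y + L • EuclideanSpace.single 2 (1 : ℝ)) ≠ v s y) →
      (∀ Λ : ℝ, Λ < 1 → ∃ s < 0, ∃ (y a : EuclideanSpace ℝ (Fin 3)), ⟪a, EuclideanSpace.single 2 (1 : ℝ)⟫_ℝ = 0 ∧
        Λ * ‖a‖ ^ 2 < (-s) * ⟪fderiv ℝ (v s) y a, a⟫_ℝ) →
      ¬ Literature.Analysis.FluidPDE.IsBackwardSingularPoint v 0 := by
  intro C v hrate hcont hmild hdiv hpol hfro hrot hvr hflat htr hax hsc hns hng hvp hcs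
  by_cases hper : ∃ ℓ : EuclideanSpace ℝ (Fin 3), ℓ ≠ 0 ∧ ∀ s < 0, ∀ y, v s (y + ℓ) = v s y
  · obtain ⟨ℓ, hℓ, hℓ'⟩ := hper
    exact Summit.NavierStokesRegularity.NavierStokesRegularity.Theorems.PoloidalWindowDoorPoloidalWindowRigidityPeriodic.nonflatLiouville_of_spatiallyPeriodic
      hrate hcont hmild hdiv hℓ hℓ'
  by_cases hrss : ∃ (c : EuclideanSpace ℝ (Fin 3)) (κ : ℝ), ∀ r : ℝ, ∀ s < 0, ∀ y,
      Real.exp r • v (Real.exp r ^ 2 * s) (Real.exp r • Literature.Analysis.FluidPDE.rotZ (κ * r) y + c) =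
        Literature.Analysis.FluidPDE.rotZ (κ * r) (v s (y + c))
  · obtain ⟨c, κ, hcκ⟩ := hrss
    exact Summit.NavierStokesRegularity.NavierStokesRegularity.Theorems.PoloidalWindowDoorPoloidalWindowRigidityFlat.not_backwardSingular_of_zero
      (Summit.NavierStokesRegularity.NavierStokesRegularity.Theorems.PoloidalWindowDoorPoloidalWindowRigidityRotatedLerayAllRates.eq_zero_of_spiralSelfSimilar_centre
        hrate hcont hmild hdiv hpol c κ hcκ)
  refine stub_residueNoPeriodNoSpiral C v hrate hcont hmild hdiv hpol hfro hrot hvr hflat htr hax hsc hns hng hvp hcs ?_ ?_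
  · intro ℓ hℓ
    by_contra hno
    push Not at hno
    exact hper ⟨ℓ, hℓ, fun s hs y => hno s hs y⟩
  · intro c κ
    by_contra hno
    push Not at hno
    exact hrss ⟨c, κ, fun r s hs y => hno r s hs y⟩

/-- The stub S2′ of rev 7, now PROVED from S2″ and the two M9 strata (`…VerticalPeriod`, `…StrainRate`). -/
theorem stub_residueNoScrewNoGauge :
    ∀ (C : ℝ) (v : ℝ → EuclideanSpace ℝ (Fin 3) → EuclideanSpace ℝ (Fin 3)),
      Literature.Analysis.FluidPDE.HasTypeITimeDecay C v →
      ContinuousOn (Function.uncurry v) (Set.Iio (0 : ℝ) ×ˢ Set.univ) →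
      (∀ s t : ℝ, s < t → t < 0 → ∀ x, v t x =
        Literature.Analysis.UnboundedOperators.heatExtension (v s) (t - s) x -
          Literature.Analysis.FluidPDE.oseenDuhamel 1 s v v t x) →
      (∀ t < 0, Literature.Analysis.FluidPDE.VectorCalculus.IsDivFree (v t)) →
      (∀ s < 0, ∀ y, ⟪Literature.Analysis.FluidPDE.curl (v s) y, EuclideanSpace.single 2 1⟫_ℝ = 0) →
      (∀ s < 0, ∀ y, ⟪fderiv ℝ (v s) y (Literature.Analysis.FluidPDE.curl (v s) y), EuclideanSpace.single 2 1⟫_ℝ = 0) →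
      (∀ s < 0, ∀ b : EuclideanSpace ℝ (Fin 3), b ≠ 0 → ∃ y,
        Literature.Analysis.FluidPDE.cross (Literature.Analysis.FluidPDE.curl (v s) y) b ≠ 0) →
      (∀ s < 0, ∃ y, fderiv ℝ (v s) y (EuclideanSpace.single 2 1) 0 ≠ 0 ∨
        fderiv ℝ (v s) y (EuclideanSpace.single 2 1) 1 ≠ 0) →
      (∀ s < 0, ∀ a : EuclideanSpace ℝ (Fin 3), a ≠ 0 → ⟪a, EuclideanSpace.single 2 1⟫_ℝ = 0 →
        ∃ y, ⟪fderiv ℝ (v s) y a, EuclideanSpace.single 2 1⟫_ℝ ≠ 0) →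
      (∀ s < 0, ∀ e : EuclideanSpace ℝ (Fin 3), e ≠ 0 → ∃ (y : EuclideanSpace ℝ (Fin 3)) (l : ℝ), v s (y + l • e) ≠ v s y) →
      (∀ s < 0, ∀ (L : EuclideanSpace ℝ (Fin 3) ≃ₗᵢ[ℝ] EuclideanSpace ℝ (Fin 3)) (c : EuclideanSpace ℝ (Fin 3)),
        ¬ Literature.Analysis.FluidPDE.IsAxisymmetric (fun y => L.symm (v s (L y + c)))) →
      (∃ lam : ℝ, 0 < lam ∧ ∃ s < 0, ∃ y, lam • v (lam ^ 2 * s) (lam • y) ≠ v s y) →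
      (∀ κ : ℝ, κ ≠ 0 → ∀ c : EuclideanSpace ℝ (Fin 3), ∃ s < 0, ∃ (a : ℝ) (y : EuclideanSpace ℝ (Fin 3)),
        v s (c + Literature.Analysis.FluidPDE.rotZ (κ * a) (y - c) + a • EuclideanSpace.single 2 (1 : ℝ)) ≠
          Literature.Analysis.FluidPDE.rotZ (κ * a) (v s y)) →
      (∀ (ψ : ℝ → EuclideanSpace ℝ (Fin 3) → ℝ) (src : ℝ → ℝ) (x₀ : EuclideanSpace ℝ (Fin 3)) (ε : ℝ → ℝ),
        ContDiffOn ℝ 2 (Function.uncurry ψ) (Set.Iio (0 : ℝ) ×ˢ Set.univ) →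
        (∀ t < 0, ∀ y, Literature.Analysis.FluidPDE.curl (v t) y 0 = fderiv ℝ (ψ t) y (EuclideanSpace.single 1 1) ∧
          Literature.Analysis.FluidPDE.curl (v t) y 1 = -fderiv ℝ (ψ t) y (EuclideanSpace.single 0 1)) →
        (∀ t < 0, ∀ x, |ψ t x - ψ t x₀| ≤ ε t * ‖x - x₀‖) →
        ContinuousOn ε (Set.Iio 0) →
        Filter.Tendsto (fun t => ε t * Real.sqrt (-t)) Filter.atBot (nhds 0) →
        ∃ t < 0, ∃ x, deriv (fun τ => ψ τ x) t + fderiv ℝ (ψ t) x (v t x) - (Δ (ψ t)) x ≠ src t) →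
      ¬ Literature.Analysis.FluidPDE.IsBackwardSingularPoint v 0 := by
  intro C v hrate hcont hmild hdiv hpol hfro hrot hvr hflat htr hax hsc hns hng
  by_cases hper : ∃ L : ℝ, 0 < L ∧ ∀ s < 0, ∀ y, v s (y + L • EuclideanSpace.single 2 (1 : ℝ)) = v s y
  · obtain ⟨L, hL, hL'⟩ := hper
    exact Summit.NavierStokesRegularity.NavierStokesRegularity.Theorems.PoloidalWindowDoorPoloidalWindowRigidityVerticalPeriod.nonflatLiouville_of_vertical_period
      hrate hcont hmild hdiv hpol hL hL'
  by_cases hstr : ∃ Λ : ℝ, Λ < 1 ∧ ∀ s < 0, ∀ (y a : EuclideanSpace ℝ (Fin 3)),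
      ⟪a, EuclideanSpace.single 2 (1 : ℝ)⟫_ℝ = 0 → (-s) * ⟪fderiv ℝ (v s) y a, a⟫_ℝ ≤ Λ * ‖a‖ ^ 2
  · obtain ⟨Λ, hΛ, hΛ'⟩ := hstr
    exact Summit.NavierStokesRegularity.NavierStokesRegularity.Theorems.PoloidalWindowDoorPoloidalWindowRigidityStrainRate.nonflatLiouville_of_small_horizontal_strain
      hrate hcont hmild hdiv hpol hΛ hΛ'
  refine stub_residueAperiodicCriticalStrain C v hrate hcont hmild hdiv hpol hfro hrot hvr hflat htr hax hsc hns hng ?_ ?_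
  · intro L hL
    by_contra hno
    push Not at hno
    exact hper ⟨L, hL, fun s hs y => hno s hs y⟩
  · intro Λ hΛ
    by_contra hno
    push Not at hno
    exact hstr ⟨Λ, hΛ, fun s hs y a ha => hno s hs y a ha⟩

/-- The former stub S2 (rev 2–6), now PROVED from S2′ and the source-gauge stratum (`…SourceGauge`). -/
theorem stub_sliceSharpNoScrewNonflatLiouville :
    ∀ (C : ℝ) (v : ℝ → EuclideanSpace ℝ (Fin 3) → EuclideanSpace ℝ (Fin 3)),
      Literature.Analysis.FluidPDE.HasTypeITimeDecay C v →
      ContinuousOn (Function.uncurry v) (Set.Iio (0 : ℝ) ×ˢ Set.univ) →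
      (∀ s t : ℝ, s < t → t < 0 → ∀ x, v t x =
        Literature.Analysis.UnboundedOperators.heatExtension (v s) (t - s) x -
          Literature.Analysis.FluidPDE.oseenDuhamel 1 s v v t x) →
      (∀ t < 0, Literature.Analysis.FluidPDE.VectorCalculus.IsDivFree (v t)) →
      (∀ s < 0, ∀ y, ⟪Literature.Analysis.FluidPDE.curl (v s) y, EuclideanSpace.single 2 1⟫_ℝ = 0) →
      (∀ s < 0, ∀ y, ⟪fderiv ℝ (v s) y (Literature.Analysis.FluidPDE.curl (v s) y), EuclideanSpace.single 2 1⟫_ℝ = 0) →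
      (∀ s < 0, ∀ b : EuclideanSpace ℝ (Fin 3), b ≠ 0 → ∃ y,
        Literature.Analysis.FluidPDE.cross (Literature.Analysis.FluidPDE.curl (v s) y) b ≠ 0) →
      (∀ s < 0, ∃ y, fderiv ℝ (v s) y (EuclideanSpace.single 2 1) 0 ≠ 0 ∨
        fderiv ℝ (v s) y (EuclideanSpace.single 2 1) 1 ≠ 0) →
      (∀ s < 0, ∀ a : EuclideanSpace ℝ (Fin 3), a ≠ 0 → ⟪a, EuclideanSpace.single 2 1⟫_ℝ = 0 →
        ∃ y, ⟪fderiv ℝ (v s) y a, EuclideanSpace.single 2 1⟫_ℝ ≠ 0) →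
      (∀ s < 0, ∀ e : EuclideanSpace ℝ (Fin 3), e ≠ 0 → ∃ (y : EuclideanSpace ℝ (Fin 3)) (l : ℝ), v s (y + l • e) ≠ v s y) →
      (∀ s < 0, ∀ (L : EuclideanSpace ℝ (Fin 3) ≃ₗᵢ[ℝ] EuclideanSpace ℝ (Fin 3)) (c : EuclideanSpace ℝ (Fin 3)),
        ¬ Literature.Analysis.FluidPDE.IsAxisymmetric (fun y => L.symm (v s (L y + c)))) →
      (∃ lam : ℝ, 0 < lam ∧ ∃ s < 0, ∃ y, lam • v (lam ^ 2 * s) (lam • y) ≠ v s y) →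
      (∀ κ : ℝ, κ ≠ 0 → ∀ c : EuclideanSpace ℝ (Fin 3), ∃ s < 0, ∃ (a : ℝ) (y : EuclideanSpace ℝ (Fin 3)),
        v s (c + Literature.Analysis.FluidPDE.rotZ (κ * a) (y - c) + a • EuclideanSpace.single 2 (1 : ℝ)) ≠
          Literature.Analysis.FluidPDE.rotZ (κ * a) (v s y)) →
      ¬ Literature.Analysis.FluidPDE.IsBackwardSingularPoint v 0 := by
  intro C v hrate hcont hmild hdiv hpol hfro hrot hvr hflat htr hax hsc hns
  by_cases hg : ∃ (ψ : ℝ → EuclideanSpace ℝ (Fin 3) → ℝ) (src : ℝ → ℝ) (x₀ : EuclideanSpace ℝ (Fin 3)) (ε : ℝ → ℝ),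
      ContDiffOn ℝ 2 (Function.uncurry ψ) (Set.Iio (0 : ℝ) ×ˢ Set.univ) ∧
      (∀ t < 0, ∀ y, Literature.Analysis.FluidPDE.curl (v t) y 0 = fderiv ℝ (ψ t) y (EuclideanSpace.single 1 1) ∧
        Literature.Analysis.FluidPDE.curl (v t) y 1 = -fderiv ℝ (ψ t) y (EuclideanSpace.single 0 1)) ∧
      (∀ t < 0, ∀ x, |ψ t x - ψ t x₀| ≤ ε t * ‖x - x₀‖) ∧
      ContinuousOn ε (Set.Iio 0) ∧
      Filter.Tendsto (fun t => ε t * Real.sqrt (-t)) Filter.atBot (nhds 0) ∧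
      (∀ t < 0, ∀ x, deriv (fun τ => ψ τ x) t + fderiv ℝ (ψ t) x (v t x) - (Δ (ψ t)) x = src t)
  · obtain ⟨ψ, src, x₀, ε, hψ, hcurl, hslope, hεc, hεt, heq⟩ := hg
    exact Summit.NavierStokesRegularity.NavierStokesRegularity.Theorems.PoloidalWindowDoorPoloidalWindowRigiditySourceGauge.nonflatLiouville_of_streamSourceGauge
      hrate hcont hmild hdiv hpol hψ hcurl heq hslope hεc hεt
  · refine stub_residueNoScrewNoGauge C v hrate hcont hmild hdiv hpol hfro hrot hvr hflat htr hax hsc hns ?_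
    intro ψ src x₀ ε hψ hcurl hslope hεc hεt
    by_contra hno
    push Not at hno
    exact hg ⟨ψ, src, x₀, ε, hψ, hcurl, hslope, hεc, hεt, fun t ht x => hno t ht x⟩

/-- COMPOSITION STEP (proved): the slice-wise sharpened residue of the birth line from S1 and S2 — case split on the
screw-symmetric stratum. -/
theorem sliceSharpNonflatLiouville_of_stubs :
    ∀ (C : ℝ) (v : ℝ → EuclideanSpace ℝ (Fin 3) → EuclideanSpace ℝ (Fin 3)),
      Literature.Analysis.FluidPDE.HasTypeITimeDecay C v →
      ContinuousOn (Function.uncurry v) (Set.Iio (0 : ℝ) ×ˢ Set.univ) →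
      (∀ s t : ℝ, s < t → t < 0 → ∀ x, v t x =
        Literature.Analysis.UnboundedOperators.heatExtension (v s) (t - s) x -
          Literature.Analysis.FluidPDE.oseenDuhamel 1 s v v t x) →
      (∀ t < 0, Literature.Analysis.FluidPDE.VectorCalculus.IsDivFree (v t)) →
      (∀ s < 0, ∀ y, ⟪Literature.Analysis.FluidPDE.curl (v s) y, EuclideanSpace.single 2 1⟫_ℝ = 0) →
      (∀ s < 0, ∀ y, ⟪fderiv ℝ (v s) y (Literature.Analysis.FluidPDE.curl (v s) y), EuclideanSpace.single 2 1⟫_ℝ = 0) →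
      (∀ s < 0, ∀ b : EuclideanSpace ℝ (Fin 3), b ≠ 0 → ∃ y,
        Literature.Analysis.FluidPDE.cross (Literature.Analysis.FluidPDE.curl (v s) y) b ≠ 0) →
      (∀ s < 0, ∃ y, fderiv ℝ (v s) y (EuclideanSpace.single 2 1) 0 ≠ 0 ∨
        fderiv ℝ (v s) y (EuclideanSpace.single 2 1) 1 ≠ 0) →
      (∀ s < 0, ∀ a : EuclideanSpace ℝ (Fin 3), a ≠ 0 → ⟪a, EuclideanSpace.single 2 1⟫_ℝ = 0 →
        ∃ y, ⟪fderiv ℝ (v s) y a, EuclideanSpace.single 2 1⟫_ℝ ≠ 0) →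
      (∀ s < 0, ∀ e : EuclideanSpace ℝ (Fin 3), e ≠ 0 → ∃ (y : EuclideanSpace ℝ (Fin 3)) (l : ℝ), v s (y + l • e) ≠ v s y) →
      (∀ s < 0, ∀ (L : EuclideanSpace ℝ (Fin 3) ≃ₗᵢ[ℝ] EuclideanSpace ℝ (Fin 3)) (c : EuclideanSpace ℝ (Fin 3)),
        ¬ Literature.Analysis.FluidPDE.IsAxisymmetric (fun y => L.symm (v s (L y + c)))) →
      (∃ lam : ℝ, 0 < lam ∧ ∃ s < 0, ∃ y, lam • v (lam ^ 2 * s) (lam • y) ≠ v s y) →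
      ¬ Literature.Analysis.FluidPDE.IsBackwardSingularPoint v 0 := by
  intro C v hrate hcont hmild hdiv hpol hfro hrot hvr hflat htr hax hsc
  by_cases hscrew : ∃ κ : ℝ, κ ≠ 0 ∧ ∃ c : EuclideanSpace ℝ (Fin 3), ∀ s < 0, ∀ (a : ℝ) (y : EuclideanSpace ℝ (Fin 3)),
      v s (c + Literature.Analysis.FluidPDE.rotZ (κ * a) (y - c) + a • EuclideanSpace.single 2 (1 : ℝ)) =
        Literature.Analysis.FluidPDE.rotZ (κ * a) (v s y)
  · exact not_backwardSingular_of_zero (stub_screwStratum C v hrate hcont hmild hdiv hpol hscrew)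
  · refine stub_sliceSharpNoScrewNonflatLiouville C v hrate hcont hmild hdiv hpol hfro hrot hvr hflat htr hax hsc ?_
    intro κ hκ c
    by_contra hno
    push Not at hno
    exact hscrew ⟨κ, hκ, c, fun s hs a y => hno s hs a y⟩

/-- THE REGISTERED LINE STUB of `slicesharp` (kept by name): the slice-wise sharpened residue — now PROVED from S1, S2. -/
theorem stub_sliceSharpNonflatLiouville :
    ∀ (C : ℝ) (v : ℝ → EuclideanSpace ℝ (Fin 3) → EuclideanSpace ℝ (Fin 3)),
      Literature.Analysis.FluidPDE.HasTypeITimeDecay C v →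
      ContinuousOn (Function.uncurry v) (Set.Iio (0 : ℝ) ×ˢ Set.univ) →
      (∀ s t : ℝ, s < t → t < 0 → ∀ x, v t x =
        Literature.Analysis.UnboundedOperators.heatExtension (v s) (t - s) x -
          Literature.Analysis.FluidPDE.oseenDuhamel 1 s v v t x) →
      (∀ t < 0, Literature.Analysis.FluidPDE.VectorCalculus.IsDivFree (v t)) →
      (∀ s < 0, ∀ y, ⟪Literature.Analysis.FluidPDE.curl (v s) y, EuclideanSpace.single 2 1⟫_ℝ = 0) →
      (∀ s < 0, ∀ y, ⟪fderiv ℝ (v s) y (Literature.Analysis.FluidPDE.curl (v s) y), EuclideanSpace.single 2 1⟫_ℝ = 0) →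
      (∀ s < 0, ∀ b : EuclideanSpace ℝ (Fin 3), b ≠ 0 → ∃ y,
        Literature.Analysis.FluidPDE.cross (Literature.Analysis.FluidPDE.curl (v s) y) b ≠ 0) →
      (∀ s < 0, ∃ y, fderiv ℝ (v s) y (EuclideanSpace.single 2 1) 0 ≠ 0 ∨
        fderiv ℝ (v s) y (EuclideanSpace.single 2 1) 1 ≠ 0) →
      (∀ s < 0, ∀ a : EuclideanSpace ℝ (Fin 3), a ≠ 0 → ⟪a, EuclideanSpace.single 2 1⟫_ℝ = 0 →
        ∃ y, ⟪fderiv ℝ (v s) y a, EuclideanSpace.single 2 1⟫_ℝ ≠ 0) →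
      (∀ s < 0, ∀ e : EuclideanSpace ℝ (Fin 3), e ≠ 0 → ∃ (y : EuclideanSpace ℝ (Fin 3)) (l : ℝ), v s (y + l • e) ≠ v s y) →
      (∀ s < 0, ∀ (L : EuclideanSpace ℝ (Fin 3) ≃ₗᵢ[ℝ] EuclideanSpace ℝ (Fin 3)) (c : EuclideanSpace ℝ (Fin 3)),
        ¬ Literature.Analysis.FluidPDE.IsAxisymmetric (fun y => L.symm (v s (L y + c)))) →
      (∃ lam : ℝ, 0 < lam ∧ ∃ s < 0, ∃ y, lam • v (lam ^ 2 * s) (lam • y) ≠ v s y) →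
      ¬ Literature.Analysis.FluidPDE.IsBackwardSingularPoint v 0 :=
  sliceSharpNonflatLiouville_of_stubs

/-- COMPOSITION (proved): the crux from the stubs, via the landed reduction
`…Sharper.poloidalWindowRigidity_of_sliceSharpNonflatLiouville`. -/
theorem PoloidalWindowRigidity_of_sliceSharp : PoloidalWindowRigidity :=
  poloidalWindowRigidity_of_sliceSharpNonflatLiouville stub_sliceSharpNonflatLiouville

end Summit.NavierStokesRegularity.NavierStokesRegularity.Theses.PoloidalWindowDoor
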